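import Literature.GroupTheory.CombinatorialGroupTheory.RandomSclFreeGroupDistinctWindows
import HarnessLib

/-!
# Random rigidity of scl (Calegari–Walker 2013): proofs, part 13 — subword counts at all positions

D. Calegari, A. Walker, *Random rigidity in the free group*, Geom. Topol. 17 (2013)
[CalegariWalker2013], §2.3–§2.4, Prop. 2.3 / Lemma 2.5: for a fixed reduced word `σ` of
length `ℓ + 1`, the number of copies of `σ` in a random reduced word of length `n` is
`n/|F_{ℓ+1}| · (1 + o(1))` with overwhelming probability as long as `|F_{ℓ+1}| = o(n)`.

Lemma 2.5 in the tree (`card_filter_windowCount_ge_le`, `card_filter_windowCount_le_le`)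
controls the copies of `σ` at the positions of an arithmetic progression of step
`S = (g+1) + (ℓ+1)` (a gap of `g + 1` free letters decorrelates consecutive windows up to a
factor `1 ± (2k+1)/q^{g+2}`). Here we sum over the `S` residue classes:

* **`sum_residue_le_card_range_filter`** — the residue-class sums are dominated by the total
  count (companion to `card_range_filter_le_sum_residue`).
* **`card_filter_subwordCount_ge_le`** — upper tail for the number of copies of `σ` starting at
  positions `≥ g + 2`: `#{w ∈ F_n : count ≥ (1+δ) n p₊} ≤ S |F_n| exp(−δ² T₀ p₊/4)`,
  `p₊ = (q^{g+2} + 2k + 1)/(2k q^{g+ℓ+2})`, `T₀ = ⌊(n − S)/S⌋`.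
* **`card_filter_subwordCount_le_le`** — lower tail:
  `#{w ∈ F_n : count ≤ (1−δ)(n − 2S) p₋} ≤ S |F_n| exp(−δ² T₀ p₋/4)`,
  `p₋ = (q^{g+2} − 2k − 1)/(2k q^{g+ℓ+2})`.
-/

noncomputable section

open Filter

namespace Literature.GroupTheory.CombinatorialGroupTheory

section SubwordCounts

open scoped Classical

/-- **Residue-class sums are at most the total count.** For any property `E` of positions, the
sum over `j < ℓ + 1` of the counts along `J = j + 1 + t(ℓ+1)`, `t < (n − (j+1))/(ℓ+1)`, is at
most the number of positions `J < n − ℓ` with `E J` (the positions are distinct and `< n − ℓ`).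
[folklore] -/
theorem sum_residue_le_card_range_filter (n ℓ : ℕ) (E : ℕ → Prop) [DecidablePred E] :
    (∑ j ∈ Finset.range (ℓ + 1), ∑ t : Fin ((n - (j + 1)) / (ℓ + 1)),
        if E (j + 1 + (t : ℕ) * (ℓ + 1)) then (1 : ℝ) else 0) ≤
      ((((Finset.range (n - ℓ)).filter E).card : ℕ) : ℝ) := by
  have hrhs : ∀ j ∈ Finset.range (ℓ + 1),
      (∑ t : Fin ((n - (j + 1)) / (ℓ + 1)), if E (j + 1 + (t : ℕ) * (ℓ + 1)) then (1 : ℝ) else 0) =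
        ((((Finset.univ.filter fun t : Fin ((n - (j + 1)) / (ℓ + 1)) =>
          E (j + 1 + (t : ℕ) * (ℓ + 1))).image fun t : Fin ((n - (j + 1)) / (ℓ + 1)) =>
            j + 1 + (t : ℕ) * (ℓ + 1)).card : ℕ) : ℝ) := by
    intro j _
    rw [Finset.sum_boole, Finset.card_image_of_injective]
    intro t t' h
    apply Fin.ext
    have h' : (t : ℕ) * (ℓ + 1) = (t' : ℕ) * (ℓ + 1) := by
      have h2 : j + 1 + (t : ℕ) * (ℓ + 1) = j + 1 + (t' : ℕ) * (ℓ + 1) := h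
      omega
    exact Nat.eq_of_mul_eq_mul_right (Nat.succ_pos ℓ) h'
  rw [Finset.sum_congr rfl hrhs]
  have hdisj : ∀ j ∈ Finset.range (ℓ + 1), ∀ j' ∈ Finset.range (ℓ + 1), j ≠ j' →
      Disjoint
        (((Finset.univ.filter fun t : Fin ((n - (j + 1)) / (ℓ + 1)) =>
          E (j + 1 + (t : ℕ) * (ℓ + 1))).image fun t : Fin ((n - (j + 1)) / (ℓ + 1)) =>
            j + 1 + (t : ℕ) * (ℓ + 1)))
        (((Finset.univ.filter fun t : Fin ((n - (j' + 1)) / (ℓ + 1)) =>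
          E (j' + 1 + (t : ℕ) * (ℓ + 1))).image fun t : Fin ((n - (j' + 1)) / (ℓ + 1)) =>
            j' + 1 + (t : ℕ) * (ℓ + 1))) := by
    intro j hj j' hj' hne
    rw [Finset.disjoint_left]
    intro J h1 h2
    rw [Finset.mem_image] at h1 h2
    obtain ⟨t, _, rfl⟩ := h1
    obtain ⟨t', _, h⟩ := h2
    rw [Finset.mem_range] at hj hj'
    -- residues: `j ≡ j' (mod ℓ+1)`
    have hmod : (j' + 1 + (t' : ℕ) * (ℓ + 1) - 1) % (ℓ + 1) =
        (j + 1 + (t : ℕ) * (ℓ + 1) - 1) % (ℓ + 1) := by rw [h]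
    rw [show j' + 1 + (t' : ℕ) * (ℓ + 1) - 1 = j' + (t' : ℕ) * (ℓ + 1) by omega,
      show j + 1 + (t : ℕ) * (ℓ + 1) - 1 = j + (t : ℕ) * (ℓ + 1) by omega,
      Nat.add_mul_mod_self_right, Nat.add_mul_mod_self_right, Nat.mod_eq_of_lt hj',
      Nat.mod_eq_of_lt hj] at hmod
    exact hne hmod.symm
  rw [← Nat.cast_sum, ← Finset.card_biUnion hdisj]
  refine (Nat.cast_le (α := ℝ)).mpr (Finset.card_le_card ?_)
  intro J hJ
  rw [Finset.mem_biUnion] at hJ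
  obtain ⟨j, hj, hJ⟩ := hJ
  rw [Finset.mem_image] at hJ
  obtain ⟨t, ht, rfl⟩ := hJ
  rw [Finset.mem_filter] at ht ⊢
  refine ⟨Finset.mem_range.mpr ?_, ht.2⟩
  have := residue_position_le t
  omega

/-- `p₋ ≥ 0`: `q^{g+2} ≥ 2k + 1` for `k ≥ 2`. [folklore] -/
theorem pminus_nonneg (k g ℓ : ℕ) (hk : 2 ≤ k) :
    0 ≤ ((2 * k - 1 : ℝ) ^ (g + 2) - 2 * k - 1) / (2 * k * (2 * k - 1 : ℝ) ^ (g + 1 + (ℓ + 1))) := by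
  have hk2 : (2 : ℝ) ≤ k := by exact_mod_cast hk
  have hq1 : (1 : ℝ) ≤ 2 * k - 1 := by linarith
  apply div_nonneg _ (by positivity)
  have h1 : (2 * k - 1 : ℝ) ^ 2 ≤ (2 * k - 1 : ℝ) ^ (g + 2) := pow_le_pow_right₀ hq1 (by omega)
  nlinarith

/-- **Copies of a fixed subword: upper tail (CW Prop. 2.3 / Lemma 2.5, all positions).** For
`k ≥ 2`, `σ ∈ F_{ℓ+1}`, a gap parameter `g` and `0 ≤ δ ≤ 2`: the reduced words of length `n` in
which `σ` occurs at `≥ (1+δ) n p₊` of the positions `J + g + 1`, `1 ≤ J < n − g − 1 − ℓ`, number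
at most `S |F_n| exp(−δ² T₀ p₊ / 4)`, `S = g + 1 + (ℓ+1)`, `T₀ = ⌊(n−S)/S⌋`,
`p₊ = (q^{g+2} + 2k + 1)/(2k q^{S})`. [cite: CalegariWalker2013, Prop. 2.3, Lemma 2.5] -/
theorem card_filter_subwordCount_ge_le (k n g ℓ : ℕ) (hk : 2 ≤ k)
    (σ : Fin (ℓ + 1) → Fin k × Bool) (hσ : σ ∈ reducedWords k (ℓ + 1))
    {δ : ℝ} (hδ : 0 ≤ δ) (hδ2 : δ ≤ 2) :
    (((reducedWords k n).filter fun w =>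
        (1 + δ) * (n * (((2 * k - 1 : ℝ) ^ (g + 2) + 2 * k + 1) /
          (2 * k * (2 * k - 1 : ℝ) ^ (g + 1 + (ℓ + 1))))) ≤
          (((Finset.range (n - (g + 1 + ℓ))).filter fun J => 1 ≤ J ∧
            ∃ h : J + (g + 1) + ℓ < n, ∀ q : Fin (ℓ + 1),
              w ⟨J + (g + 1) + q, by omega⟩ = σ q).card : ℝ)).card : ℝ) ≤
      (g + 1 + (ℓ + 1) : ℕ) * (reducedWords k n).card *
        Real.exp (-(δ ^ 2 * ((((n - (g + 1 + (ℓ + 1))) / (g + 1 + (ℓ + 1)) : ℕ) : ℝ) *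
          (((2 * k - 1 : ℝ) ^ (g + 2) + 2 * k + 1) /
            (2 * k * (2 * k - 1 : ℝ) ^ (g + 1 + (ℓ + 1))))) / 4)) := by
  set S := g + 1 + (ℓ + 1) with hS
  set p : ℝ := ((2 * k - 1 : ℝ) ^ (g + 2) + 2 * k + 1) /
    (2 * k * (2 * k - 1 : ℝ) ^ (g + 1 + (ℓ + 1))) with hp
  set T₀ := (n - S) / S with hT₀
  have hk2 : (2 : ℝ) ≤ k := by exact_mod_cast hk
  have hq1 : (1 : ℝ) ≤ 2 * k - 1 := by linarith
  have hppos : 0 ≤ p := by rw [hp]; positivity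
  have hSpos : 0 < S := by omega
  have hSeq : g + 1 + ℓ + 1 = S := by omega
  -- the residue events (Lemma 2.5 along `J = j + 1 + t S`)
  set T : ℕ → ℕ := fun j => (n - (j + 1)) / S with hT
  have hpos_le : ∀ (j : ℕ) (t : Fin (T j)), j + 1 + (t : ℕ) * S + S ≤ n := by
    intro j t
    have h1 : ((t : ℕ) + 1) * S ≤ n - (j + 1) :=
      (Nat.le_div_iff_mul_le hSpos).mp (Nat.succ_le_of_lt t.isLt)
    rw [add_mul, one_mul] at h1
    omega
  set A : ℕ → Finset (Fin n → Fin k × Bool) := fun j =>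
    (reducedWords k n).filter fun w => (1 + δ) * (T j * p) ≤
      ∑ t : Fin (T j), if (∀ q : Fin (ℓ + 1),
          w ⟨j + 1 + (t : ℕ) * S + (g + 1) + q, by have := hpos_le j t; omega⟩ = σ q)
          then (1 : ℝ) else 0 with hA
  have hAcard : ∀ j, j < S →
      ((A j).card : ℝ) ≤ (reducedWords k n).card * Real.exp (-(δ ^ 2 * (T₀ * p) / 4)) := by
    intro j hj
    have h := card_filter_windowCount_ge_le k n g ℓ (T j) hk (fun t => j + 1 + t * S) (by omega)
      (by intro t u htu
          show j + 1 + t * S + (g + 1 + (ℓ + 1)) ≤ j + 1 + u * S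
          have := Nat.mul_le_mul_right S (Nat.succ_le_of_lt htu)
          rw [Nat.succ_mul] at this
          rw [← hS]; omega)
      (by intro t ht
          show j + 1 + t * S + (g + 1 + (ℓ + 1)) ≤ n
          rw [← hS]; exact hpos_le j ⟨t, ht⟩)
      σ hσ hδ hδ2
    refine h.trans (mul_le_mul_of_nonneg_left ?_ (Nat.cast_nonneg _))
    rw [Real.exp_le_exp]
    have hTj : (T₀ : ℝ) ≤ T j := by
      have : T₀ ≤ T j := Nat.div_le_div_right (by omega)
      exact_mod_cast this
    have : δ ^ 2 * (T₀ * p) ≤ δ ^ 2 * (T j * p) :=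
      mul_le_mul_of_nonneg_left (mul_le_mul_of_nonneg_right hTj hppos) (sq_nonneg δ)
    linarith
  -- `∑_j T j ≤ n`
  have hTsum : ∑ j ∈ Finset.range S, (T j : ℝ) ≤ n := by
    have h1 : ∀ j ∈ Finset.range S, (T j : ℝ) ≤ (n : ℝ) / S := by
      intro j _
      have h := Nat.cast_div_le (α := ℝ) (m := n - (j + 1)) (n := S)
      refine h.trans (div_le_div_of_nonneg_right ?_ (by positivity))
      exact_mod_cast Nat.sub_le n (j + 1)
    calc ∑ j ∈ Finset.range S, (T j : ℝ) ≤ ∑ _j ∈ Finset.range S, (n : ℝ) / S := Finset.sum_le_sum h1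
      _ = n := by
          rw [Finset.sum_const, Finset.card_range, nsmul_eq_mul]
          have : (S : ℝ) ≠ 0 := by exact_mod_cast hSpos.ne'
          field_simp
  -- the inclusion of events
  set E : (Fin n → Fin k × Bool) → ℕ → Prop := fun w J => 1 ≤ J ∧
      ∃ h : J + (g + 1) + ℓ < n, ∀ q : Fin (ℓ + 1), w ⟨J + (g + 1) + q, by omega⟩ = σ q with hE
  have hsub : ((reducedWords k n).filter fun w => (1 + δ) * (n * p) ≤
      (((Finset.range (n - (g + 1 + ℓ))).filter fun J => E w J).card : ℝ)) ⊆
      (Finset.range S).biUnion A := by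
    intro w hw
    rw [Finset.mem_filter] at hw
    obtain ⟨hwred, hcount⟩ := hw
    rw [Finset.mem_biUnion]
    by_contra hno
    -- all residue counts are small
    have hsmall : ∀ j ∈ Finset.range S,
        (∑ t : Fin (T j), if (∀ q : Fin (ℓ + 1),
            w ⟨j + 1 + (t : ℕ) * S + (g + 1) + q, by have := hpos_le j t; omega⟩ = σ q)
            then (1 : ℝ) else 0) < (1 + δ) * (T j * p) := by
      intro j hj
      by_contra hge
      rw [not_lt] at hge
      exact hno ⟨j, hj, Finset.mem_filter.mpr ⟨hwred, hge⟩⟩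
    -- the residue decomposition of the total count
    have hres := card_range_filter_le_sum_residue n (g + 1 + ℓ) (E w) (fun J hJ => hJ.1)
    rw [hSeq] at hres
    have hcongr : ∀ j ∈ Finset.range S,
        (∑ t : Fin (T j), if E w (j + 1 + (t : ℕ) * S) then (1 : ℝ) else 0) =
          ∑ t : Fin (T j), if (∀ q : Fin (ℓ + 1),
            w ⟨j + 1 + (t : ℕ) * S + (g + 1) + q, by have := hpos_le j t; omega⟩ = σ q)
            then (1 : ℝ) else 0 := by
      intro j _
      refine Finset.sum_congr rfl fun t _ => ?_
      have hiff : E w (j + 1 + (t : ℕ) * S) ↔ ∀ q : Fin (ℓ + 1),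
          w ⟨j + 1 + (t : ℕ) * S + (g + 1) + q, by have := hpos_le j t; omega⟩ = σ q := by
        rw [hE]
        constructor
        · rintro ⟨_, _, h⟩; exact h
        · intro h; exact ⟨by omega, by have := hpos_le j t; omega, h⟩
      rw [if_congr hiff rfl rfl]
    rw [Finset.sum_congr rfl hcongr] at hres
    have hlt : (∑ j ∈ Finset.range S, ∑ t : Fin (T j), if (∀ q : Fin (ℓ + 1),
        w ⟨j + 1 + (t : ℕ) * S + (g + 1) + q, by have := hpos_le j t; omega⟩ = σ q)
        then (1 : ℝ) else 0) < (1 + δ) * (n * p) := by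
      have hne : (Finset.range S).Nonempty := ⟨0, Finset.mem_range.mpr hSpos⟩
      calc _ < ∑ j ∈ Finset.range S, (1 + δ) * (T j * p) := Finset.sum_lt_sum_of_nonempty hne hsmall
        _ = (1 + δ) * p * ∑ j ∈ Finset.range S, (T j : ℝ) := by
            rw [Finset.mul_sum]; refine Finset.sum_congr rfl fun j _ => ?_; ring
        _ ≤ (1 + δ) * p * n := mul_le_mul_of_nonneg_left hTsum (by positivity)
        _ = (1 + δ) * (n * p) := by ring
    linarith
  have hcard := (Finset.card_le_card hsub).trans Finset.card_biUnion_le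
  have hcard' := (Nat.cast_le (α := ℝ)).mpr hcard
  rw [Nat.cast_sum] at hcard'
  refine hcard'.trans ?_
  calc ∑ j ∈ Finset.range S, ((A j).card : ℝ)
      ≤ ∑ _j ∈ Finset.range S, (reducedWords k n).card * Real.exp (-(δ ^ 2 * (T₀ * p) / 4)) :=
        Finset.sum_le_sum fun j hj => hAcard j (Finset.mem_range.mp hj)
    _ = (S : ℕ) * (reducedWords k n).card * Real.exp (-(δ ^ 2 * (T₀ * p) / 4)) := by
        rw [Finset.sum_const, Finset.card_range, nsmul_eq_mul]; ring

/-- **Copies of a fixed subword: lower tail (CW Prop. 2.3 / Lemma 2.5, all positions).** For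
`k ≥ 2`, `σ ∈ F_{ℓ+1}`, a gap parameter `g` and `0 ≤ δ ≤ 1`: the reduced words of length `n` in
which `σ` occurs at `≤ (1−δ)(n − 2S) p₋` of the positions `J + g + 1`, `1 ≤ J < n − g − 1 − ℓ`,
number at most `S |F_n| exp(−δ² T₀ p₋ / 4)`, `S = g + 1 + (ℓ+1)`, `T₀ = ⌊(n−S)/S⌋`,
`p₋ = (q^{g+2} − 2k − 1)/(2k q^{S})`. [cite: CalegariWalker2013, Prop. 2.3, Lemma 2.5] -/
theorem card_filter_subwordCount_le_le (k n g ℓ : ℕ) (hk : 2 ≤ k)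
    (σ : Fin (ℓ + 1) → Fin k × Bool) (hσ : σ ∈ reducedWords k (ℓ + 1))
    {δ : ℝ} (hδ : 0 ≤ δ) (hδ1 : δ ≤ 1) :
    (((reducedWords k n).filter fun w =>
        (((Finset.range (n - (g + 1 + ℓ))).filter fun J => 1 ≤ J ∧
            ∃ h : J + (g + 1) + ℓ < n, ∀ q : Fin (ℓ + 1),
              w ⟨J + (g + 1) + q, by omega⟩ = σ q).card : ℝ) ≤
          (1 - δ) * (((n : ℝ) - 2 * (g + 1 + (ℓ + 1) : ℕ)) *
            (((2 * k - 1 : ℝ) ^ (g + 2) - 2 * k - 1) /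
              (2 * k * (2 * k - 1 : ℝ) ^ (g + 1 + (ℓ + 1)))))).card : ℝ) ≤
      (g + 1 + (ℓ + 1) : ℕ) * (reducedWords k n).card *
        Real.exp (-(δ ^ 2 * ((((n - (g + 1 + (ℓ + 1))) / (g + 1 + (ℓ + 1)) : ℕ) : ℝ) *
          (((2 * k - 1 : ℝ) ^ (g + 2) - 2 * k - 1) /
            (2 * k * (2 * k - 1 : ℝ) ^ (g + 1 + (ℓ + 1))))) / 4)) := by
  set S := g + 1 + (ℓ + 1) with hS
  set p : ℝ := ((2 * k - 1 : ℝ) ^ (g + 2) - 2 * k - 1) /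
    (2 * k * (2 * k - 1 : ℝ) ^ (g + 1 + (ℓ + 1))) with hp
  set T₀ := (n - S) / S with hT₀
  have hppos : 0 ≤ p := pminus_nonneg k g ℓ hk
  have hSpos : 0 < S := by omega
  have hSeq : g + 1 + ℓ + 1 = S := by omega
  have hSR : (0 : ℝ) < S := by exact_mod_cast hSpos
  -- the residue events
  set T : ℕ → ℕ := fun j => (n - (j + 1)) / S with hT
  have hpos_le : ∀ (j : ℕ) (t : Fin (T j)), j + 1 + (t : ℕ) * S + S ≤ n := by
    intro j t
    have h1 : ((t : ℕ) + 1) * S ≤ n - (j + 1) :=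
      (Nat.le_div_iff_mul_le hSpos).mp (Nat.succ_le_of_lt t.isLt)
    rw [add_mul, one_mul] at h1
    omega
  set B : ℕ → Finset (Fin n → Fin k × Bool) := fun j =>
    (reducedWords k n).filter fun w =>
      (∑ t : Fin (T j), if (∀ q : Fin (ℓ + 1),
          w ⟨j + 1 + (t : ℕ) * S + (g + 1) + q, by have := hpos_le j t; omega⟩ = σ q)
          then (1 : ℝ) else 0) ≤ (1 - δ) * (T j * p) with hB
  have hBcard : ∀ j, j < S →
      ((B j).card : ℝ) ≤ (reducedWords k n).card * Real.exp (-(δ ^ 2 * (T₀ * p) / 4)) := by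
    intro j hj
    have h := card_filter_windowCount_le_le k n g ℓ (T j) hk (fun t => j + 1 + t * S) (by omega)
      (by intro t u htu
          show j + 1 + t * S + (g + 1 + (ℓ + 1)) ≤ j + 1 + u * S
          have := Nat.mul_le_mul_right S (Nat.succ_le_of_lt htu)
          rw [Nat.succ_mul] at this
          rw [← hS]; omega)
      (by intro t ht
          show j + 1 + t * S + (g + 1 + (ℓ + 1)) ≤ n
          rw [← hS]; exact hpos_le j ⟨t, ht⟩)
      σ hσ hδ (by linarith)
    refine h.trans (mul_le_mul_of_nonneg_left ?_ (Nat.cast_nonneg _))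
    rw [Real.exp_le_exp]
    have hTj : (T₀ : ℝ) ≤ T j := by
      have : T₀ ≤ T j := Nat.div_le_div_right (by omega)
      exact_mod_cast this
    have : δ ^ 2 * (T₀ * p) ≤ δ ^ 2 * (T j * p) :=
      mul_le_mul_of_nonneg_left (mul_le_mul_of_nonneg_right hTj hppos) (sq_nonneg δ)
    linarith
  -- `∑_j T j ≥ n - 2S`
  have hTsum : (n : ℝ) - 2 * (S : ℕ) ≤ ∑ j ∈ Finset.range S, (T j : ℝ) := by
    have h1 : ∀ j ∈ Finset.range S, ((n : ℝ) - 2 * (S : ℕ)) / S ≤ (T j : ℝ) := by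
      intro j hj
      rw [Finset.mem_range] at hj
      rw [div_le_iff₀ hSR]
      -- `S * T j ≥ n - (j+1) - (S-1)`
      have hdm := Nat.div_add_mod (n - (j + 1)) S
      have hml := Nat.mod_lt (n - (j + 1)) hSpos
      have h2 : n ≤ S * T j + (j + 1) + S := by
        show n ≤ S * ((n - (j + 1)) / S) + (j + 1) + S
        omega
      have h3 := (Nat.cast_le (α := ℝ)).mpr h2
      push_cast at h3
      have hjR : (j : ℝ) + 1 ≤ S := by exact_mod_cast hj
      nlinarith
    calc (n : ℝ) - 2 * (S : ℕ) = ∑ _j ∈ Finset.range S, ((n : ℝ) - 2 * (S : ℕ)) / S := by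
          rw [Finset.sum_const, Finset.card_range, nsmul_eq_mul]
          field_simp
      _ ≤ ∑ j ∈ Finset.range S, (T j : ℝ) := Finset.sum_le_sum h1
  -- the inclusion of events
  set E : (Fin n → Fin k × Bool) → ℕ → Prop := fun w J => 1 ≤ J ∧
      ∃ h : J + (g + 1) + ℓ < n, ∀ q : Fin (ℓ + 1), w ⟨J + (g + 1) + q, by omega⟩ = σ q with hE
  have hsub : ((reducedWords k n).filter fun w =>
      (((Finset.range (n - (g + 1 + ℓ))).filter fun J => E w J).card : ℝ) ≤
        (1 - δ) * (((n : ℝ) - 2 * (S : ℕ)) * p)) ⊆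
      (Finset.range S).biUnion B := by
    intro w hw
    rw [Finset.mem_filter] at hw
    obtain ⟨hwred, hcount⟩ := hw
    rw [Finset.mem_biUnion]
    by_contra hno
    -- all residue counts are large
    have hlarge : ∀ j ∈ Finset.range S, (1 - δ) * (T j * p) <
        ∑ t : Fin (T j), if (∀ q : Fin (ℓ + 1),
            w ⟨j + 1 + (t : ℕ) * S + (g + 1) + q, by have := hpos_le j t; omega⟩ = σ q)
            then (1 : ℝ) else 0 := by
      intro j hj
      by_contra hge
      rw [not_lt] at hge
      exact hno ⟨j, hj, Finset.mem_filter.mpr ⟨hwred, hge⟩⟩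
    -- the residue decomposition of the total count (reverse inequality)
    have hres := sum_residue_le_card_range_filter n (g + 1 + ℓ) (E w)
    rw [hSeq] at hres
    have hcongr : ∀ j ∈ Finset.range S,
        (∑ t : Fin (T j), if E w (j + 1 + (t : ℕ) * S) then (1 : ℝ) else 0) =
          ∑ t : Fin (T j), if (∀ q : Fin (ℓ + 1),
            w ⟨j + 1 + (t : ℕ) * S + (g + 1) + q, by have := hpos_le j t; omega⟩ = σ q)
            then (1 : ℝ) else 0 := by
      intro j _
      refine Finset.sum_congr rfl fun t _ => ?_
      have hiff : E w (j + 1 + (t : ℕ) * S) ↔ ∀ q : Fin (ℓ + 1),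
          w ⟨j + 1 + (t : ℕ) * S + (g + 1) + q, by have := hpos_le j t; omega⟩ = σ q := by
        rw [hE]
        constructor
        · rintro ⟨_, _, h⟩; exact h
        · intro h; exact ⟨by omega, by have := hpos_le j t; omega, h⟩
      rw [if_congr hiff rfl rfl]
    rw [Finset.sum_congr rfl hcongr] at hres
    have hlt : (1 - δ) * (((n : ℝ) - 2 * (S : ℕ)) * p) <
        ∑ j ∈ Finset.range S, ∑ t : Fin (T j), if (∀ q : Fin (ℓ + 1),
          w ⟨j + 1 + (t : ℕ) * S + (g + 1) + q, by have := hpos_le j t; omega⟩ = σ q)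
          then (1 : ℝ) else 0 := by
      have hne : (Finset.range S).Nonempty := ⟨0, Finset.mem_range.mpr hSpos⟩
      have hδp : 0 ≤ (1 - δ) * p := mul_nonneg (by linarith) hppos
      calc (1 - δ) * (((n : ℝ) - 2 * (S : ℕ)) * p) = (1 - δ) * p * ((n : ℝ) - 2 * (S : ℕ)) := by ring
        _ ≤ (1 - δ) * p * ∑ j ∈ Finset.range S, (T j : ℝ) := mul_le_mul_of_nonneg_left hTsum hδp
        _ = ∑ j ∈ Finset.range S, (1 - δ) * (T j * p) := by
            rw [Finset.mul_sum]; refine Finset.sum_congr rfl fun j _ => ?_; ring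
        _ < _ := Finset.sum_lt_sum_of_nonempty hne hlarge
    linarith
  have hcard := (Finset.card_le_card hsub).trans Finset.card_biUnion_le
  have hcard' := (Nat.cast_le (α := ℝ)).mpr hcard
  rw [Nat.cast_sum] at hcard'
  refine hcard'.trans ?_
  calc ∑ j ∈ Finset.range S, ((B j).card : ℝ)
      ≤ ∑ _j ∈ Finset.range S, (reducedWords k n).card * Real.exp (-(δ ^ 2 * (T₀ * p) / 4)) :=
        Finset.sum_le_sum fun j hj => hBcard j (Finset.mem_range.mp hj)
    _ = (S : ℕ) * (reducedWords k n).card * Real.exp (-(δ ^ 2 * (T₀ * p) / 4)) := by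
        rw [Finset.sum_const, Finset.card_range, nsmul_eq_mul]; ring

end SubwordCounts

end Literature.GroupTheory.CombinatorialGroupTheory

end
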